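import Summits.HodgeConjecture.CorCM.HypLiu418.RecordSystemAlongConj
import Summits.HodgeConjecture.CorCM.B01.Transposition.HComp.RecordSystemConj
import HarnessLib

/-!
# B1 ∘ B2 — «(3) as an EQUALITY»: the `c`-twisted models are a record system of `(cH, τ̄ = conj ∘ τ, T)`

Cell `hodgecm-mathlib`, fan A, off-place half of `HLiu418`, director g1 HANDOFF §7 item (3) (A-p01's memo `OFFPLACE-Liu418-dependency.md`
§(3): «prefer an equality-level corollary `∃ R̄′ …, R̄′.M = …`»).  Composition of the two landed variances of Deligne's record systems of
`Sh(U(H), 𝔹²)` ([Deligne1979ShimuraVarieties] 2.2.5):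

* B1 ✔ `exists_conj` — `(H, τ, T) ↦ (cH, τ, T̄)`, models `K' ↦ M_{c⁻¹K'} ⊗_{L,c} L`;
* B2 ✔ `RecordSystem.exists_alongConj` — `(H', τ, T') ↦ (H', τ̄, T̄')`, SAME models;

so that `(H, τ, T) ↦ (cH, τ̄, conjFrame (conjFrame T) = T)`: the `c`-TWISTED model tower of `R` is a record system of the conjugate hermitian space
read at the conjugate embedding, in the ORIGINAL frame `T` (`(cH)^{τ̄} = H^{τ}` is the same complex matrix: ✔ `map_starRingEnd_comp_eq_conjGram_map`,
`conjGram_conjGram`).  Plus the `subst`-trivial casts of a record system along equalities of the frame / the embedding (for consumers whose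
datum is spelled `(ι₀, frameOf V̄)`), and the END-currency corollary of ✔ R6 `exists_recordSystemConj_X_sec42DataOf_levelOf_eq` along `conj`.

KERNEL: theorems only; no def, no instance, no named fact, no `sorry`.  HC_CM is NOT proved here; HC_CM is proved only modulo the 7 printed
citations until rung 0 closes.

References: [Deligne1979ShimuraVarieties] 2.2.4–2.2.5; [Milne2005ShimuraVarieties] §12, Def. 12.8 (62) p. 114; [Liu2021] §4.2, Prop. C.5.
-/

set_option autoImplicit false

noncomputable section

open CategoryTheory AlgebraicGeometry NumberField IsDedekindDomain Matrix
open Literature.AlgebraicGeometry.Motives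
open Literature.NumberTheory.Automorphic.Liu2021.AppendixC (C5.OpenCompactSubgroup C5.SmallLevel)

namespace Summit.HodgeConjecture.CorCM.Model.RecordSystemConj

open Literature.AlgebraicGeometry.ShimuraVarieties Literature.AlgebraicGeometry.ShimuraVarieties.UnitaryCanonicalModel
open Literature.NumberTheory.Automorphic Literature.NumberTheory.Automorphic.UnitaryGroup
open Literature.Geometry.ComplexHyperbolic Literature.Geometry.ComplexHyperbolic.BallModel
open Summit.HodgeConjecture.CorCM.D2Bridge.UnitaryGroupConj

/-! ## §1 Frame and Gram bookkeeping; casts of a record system along equalities of the frame / the embedding -/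

section Casts

variable {L : Type} [Field L] [NumberField L] [IsCMField L]

omit [NumberField L] [IsCMField L] in
/-- `conj (conj T) = T` entrywise. [folklore] -/
@[simp] theorem conjFrame_conjFrame (T : GL (Fin 3) ℂ) : conjFrame (conjFrame T) = T :=
  Units.ext (Matrix.ext fun i j => by simp [conjFrame])

/-- `c(c(H)) = H` entrywise. [folklore] -/
@[simp] theorem conjGram_conjGram (H : Matrix (Fin 3) (Fin 3) L) : conjGram L (conjGram L H) = H := by
  ext i j
  simp only [Matrix.map_apply, RingHom.coe_coe]
  exact IsCMField.complexConj_apply_apply L (H i j)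

/-- **`Tᴴ (cH)^{τ̄} T = J`**: the ORIGINAL frame `T` of `H` at `τ` is a frame of `cH` at `τ̄ = conj ∘ τ`, because `(cH)^{τ̄} = H^{τ}` is the same
complex matrix. [folklore] -/
theorem formCongr_conjGram_starRingEnd_comp (H : Matrix (Fin 3) (Fin 3) L) (τ : L →+* ℂ) (T : GL (Fin 3) ℂ)
    (hT : formCongr (starRingEnd ℂ) T (H.map τ) = BallModel.J) :
    formCongr (starRingEnd ℂ) T ((conjGram L H).map ((starRingEnd ℂ).comp τ)) = BallModel.J := by
  rw [map_starRingEnd_comp_eq_conjGram_map, conjGram_conjGram]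
  exact hT

variable {H : Matrix (Fin 3) (Fin 3) L} {τ : L →+* ℂ} {T : GL (Fin 3) ℂ} {hT : formCongr (starRingEnd ℂ) T (H.map τ) = BallModel.J}
  {K₀ : C5.OpenCompactSubgroup ↥(finAdelic (↥(maximalRealSubfield L)) L (IsCMField.complexConj L) 3 H)}

/-- **Cast of a record system along an equality of frames** (`T = T'`; the frame index `hT'` is any proof): same models. [folklore] -/
theorem RecordSystem.exists_eq_M_of_frame_eq {T' : GL (Fin 3) ℂ} (e : T = T')
    (hT' : formCongr (starRingEnd ℂ) T' (H.map τ) = BallModel.J) (R : RecordSystem L H τ T hT K₀) :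
    ∃ R' : RecordSystem L H τ T' hT' K₀, R'.M = R.M := by
  subst e
  exact ⟨R, rfl⟩

/-- **Cast of a record system along an equality of embeddings** (`τ = τ'`, e.g. `conj ∘ ι₁ = ι₀ := (InfinitePlace.mk ι₁).embedding` off place):
same models. [folklore] -/
theorem RecordSystem.exists_eq_M_of_emb_eq {τ' : L →+* ℂ} (e : τ = τ')
    (hT' : formCongr (starRingEnd ℂ) T (H.map τ') = BallModel.J) (R : RecordSystem L H τ T hT K₀) :
    ∃ R' : RecordSystem L H τ' T hT' K₀, R'.M = R.M := by
  subst e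
  exact ⟨R, rfl⟩

end Casts

/-! ## §2 B1 ∘ B2: the `c`-twisted models as a record system of `(cH, conj ∘ τ, T)` -/

section ConjAlongConj

variable {L : Type} [Field L] [NumberField L] [IsCMField L] {H : Matrix (Fin 3) (Fin 3) L}
  {τ : L →+* ℂ} {T : GL (Fin 3) ℂ} {hT : formCongr (starRingEnd ℂ) T (H.map τ) = BallModel.J}
  {K₀ : C5.OpenCompactSubgroup ↥(finAdelic (↥(maximalRealSubfield L)) L (IsCMField.complexConj L) 3 H)}

/-- **B1 ∘ B2 — «(3) as an EQUALITY of model functors».**  For every Deligne record system `R` of `Sh(U(H), 𝔹²)` below `K₀` read at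
`(τ, T)` there is a record system `R″` of the CONJUGATE space `cH` below `c(K₀)`, read at the CONJUGATE embedding `τ̄ = conj ∘ τ` in the
ORIGINAL frame `T`, whose model functor IS the `c`-twist `K' ↦ M_{c⁻¹K'} ⊗_{L,c} L` of `R`'s: ✔ `exists_conj` (B1: `(cH, τ, T̄)`, these models),
then ✔ `RecordSystem.exists_alongConj` (B2: `(cH, τ̄, conj T̄)`, same models), then `conj (conj T) = T`.  ([Milne2005ShimuraVarieties] §12 /
Milne–Shih: the canonical model of `Sh(G, X̄)`; here elementary from the two variances.)
[cite: Deligne1979ShimuraVarieties, 2.2.4–2.2.5] [cite: Milne2005ShimuraVarieties, §12 and Def. 12.8 (62) p. 114] -/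
theorem RecordSystem.exists_conj_alongConj (R : RecordSystem L H τ T hT K₀) :
    ∃ R'' : RecordSystem L (conjGram L H) ((starRingEnd ℂ).comp τ) T (formCongr_conjGram_starRingEnd_comp H τ T hT)
        (conjLevel₀ L H K₀),
      R''.M = smallLevelConjBack L H K₀ ⋙ R.M ⋙
        baseChangeHom ((IsCMField.complexConj L : L ≃ₐ[↥(maximalRealSubfield L)] L) : L →+* L) := by
  obtain ⟨R₁, hM₁⟩ := exists_conj R
  obtain ⟨R₂, hM₂⟩ := RecordSystem.exists_alongConj R₁
  obtain ⟨R₃, hM₃⟩ := RecordSystem.exists_eq_M_of_frame_eq (conjFrame_conjFrame T)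
    (formCongr_conjGram_starRingEnd_comp H τ T hT) R₂
  exact ⟨R₃, by rw [hM₃, hM₂, hM₁]⟩

end ConjAlongConj

end Summit.HodgeConjecture.CorCM.Model.RecordSystemConj

/-! ## §3 END currency: R6 along `conj` — the off-place tower `ℭ(ι₁, V)` is the model tower of a record of `(V.Hmᵀ, conj ∘ ι₁, frameOf V)` -/

namespace Summit.HodgeConjecture.CorCM.D2Bridge.MuConjIdent

open CategoryTheory NumberField
open Literature.NumberTheory.Automorphic Literature.NumberTheory.Automorphic.UnitaryGroup
open Literature.AlgebraicGeometry.ShimuraVarieties.UnitaryCanonicalModel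
open Literature.NumberTheory.Automorphic.Liu2021.AppendixC
open Summit.HodgeConjecture.CorCM.Model Summit.HodgeConjecture.CorCM.HComp
open Summit.HodgeConjecture.CorCM.Model.RecordSystemConj
open Summit.HodgeConjecture.CorCM.D2Bridge.UnitaryGroupConj

/-- **(e) along `conj`, END-FACING at the literal datum of record** (`6 ≤ [F:ℚ]`, `ℭ := sec42DataOf h iso F ι₁ V Φ`): there is a Deligne record
`R″` of the CONJUGATE space `c(V.Hm) = V.Hmᵀ` below `c(K_f(3))`, read at the CONJUGATE embedding `conj ∘ ι₁` (the embedding AT the place of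
`ι₁` when `ι₁` is off place) in the frame `frameOf V`, such that `c⁻¹(·) ⋙ ℭ₄.cpt.X = R″.M` and `ℭ.X_{levelOf K} = R″.M_{c(levelOf K)}` for every
subgroup `K` — ✔ R6 `exists_recordSystemConj_X_sec42DataOf_levelOf_eq` followed by B2 ✔ `RecordSystem.exists_alongConj` and the frame cast
`conj (conj (frameOf V)) = frameOf V`.  HC_CM is NOT proved; nothing displayed by an END is inhabited here.
[cite: Liu2021, §4.2, Thm. 4.18 (1) and Prop. C.5] [cite: Deligne1979ShimuraVarieties, 2.2.5 and Cor. 2.7.21] -/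
theorem exists_recordSystemConjAlongConj_X_sec42DataOf_levelOf_eq (h : exists_recordSystem) {F : CMField} {ι₁ : F →+* ℂ}
    (V : HermSpace3 F ι₁) (Φ : Literature.AlgebraicGeometry.Motives.CMType F)
    (iso : ∀ (F : CMField) (ι₁ : F →+* ℂ) (_ : HermSpace3 F ι₁) (_ : Literature.AlgebraicGeometry.Motives.CMType F), ℕ → Prop)
    (h6 : 6 ≤ Module.finrank ℚ F) :
    ∃ R'' : RecordSystem F (conjGram F V.Hm) ((starRingEnd ℂ).comp ι₁) (frameOf V)
        (formCongr_conjGram_starRingEnd_comp V.Hm ι₁ (frameOf V) (formCongr_frameOf V)) (conjLevel₀ F V.Hm (K3 V)),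
      smallLevelConjBack F V.Hm (K3 V) ⋙ (sec42DataOfFourLe h V Φ (le_trans (by norm_num) h6) (iso F ι₁ V Φ)).cpt.X = R''.M ∧
      ∀ K : Subgroup (honestP5Of h F ι₁ V Φ).G,
        (sec42DataOf h iso F ι₁ V Φ).X ((sec42DataOf h iso F ι₁ V Φ).levelOf K) =
          R''.M.obj (⟨C5.OpenCompactSubgroup.transport (groupConj F V.Hm)
              ((sec42DataOfFourLe h V Φ (le_trans (by norm_num) h6) (iso F ι₁ V Φ)).levelOf K).1,
            C5.OpenCompactSubgroup.transport_mono (groupConj F V.Hm)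
              ((sec42DataOfFourLe h V Φ (le_trans (by norm_num) h6) (iso F ι₁ V Φ)).levelOf K).2⟩ :
          C5.SmallLevel (conjLevel₀ F V.Hm (K3 V))) := by
  obtain ⟨R₁, h₁, h₂⟩ := exists_recordSystemConj_X_sec42DataOf_levelOf_eq h V Φ iso h6
  obtain ⟨R₂, hM₂⟩ := RecordSystem.exists_alongConj R₁
  obtain ⟨R₃, hM₃⟩ := RecordSystem.exists_eq_M_of_frame_eq (conjFrame_conjFrame (frameOf V))
    (formCongr_conjGram_starRingEnd_comp V.Hm ι₁ (frameOf V) (formCongr_frameOf V)) R₂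
  refine ⟨R₃, ?_, fun K => ?_⟩
  · rw [hM₃, hM₂]
    exact h₁
  · rw [hM₃, hM₂]
    exact h₂ K

end Summit.HodgeConjecture.CorCM.D2Bridge.MuConjIdent

end
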